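import Literature.Analysis.PDE.ConservationLawWeakStrong
import Literature.Analysis.PDE.ConservationLawMollifier

/-!
# Weak solutions and entropy inequalities tested against Lipschitz functions

Topic `Literature/Analysis/PDE`. Second layer of the formalization of Dafermos' weak–strong
uniqueness theorem (`Literature.Analysis.PDE.ConservationLaw.dafermos_weak_strong_uniqueness`,
Dafermos 2000, Thm 5.2.1). Dafermos formulates weak solutions (4.1.6) and admissibility (4.3.4)
with LIPSCHITZ test functions "with compact support in `ℝ^m × [0,T)`", and his proof of
Thm 5.2.1 uses the Lipschitz vector field `ψ Dη(Ū)` as a test function ((5.2.7), p. 127). The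
tree's `IsWeakSolution` / `IsEntropyAdmissible` quantify over `C¹` test functions
(`IsTestFunction`), so we prove here that both extend to Lipschitz test functions:

* `IsWeakSolution.lipschitzTest` — for `Φ` Lipschitz with compact support and `Φ = 0` for
  `t ≥ T'`, `T' < T`:
  `∫_{(0,T)×ℝ^m} [∂ₜΦ • U + ∑_α ∂_αΦ • G_α(U)] + ∫ Φ(0,x) • U₀(x) dx = 0`,
  with `∂Φ` the a.e.-defined Fréchet derivative (Rademacher) and the space–time integral written
  as ONE integral over the slab;
* `IsEntropyAdmissible.lipschitzTest` — the entropy inequality for nonnegative such `Φ`.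

Proof: mollify `Φ` (layer `ConservationLawMollifier`): `ρ̄_k ⋆ Φ` is an admissible `C¹` test
function for `k` large, its derivatives are `ρ̄_k ⋆ ∂Φ`, bounded by the Lipschitz constant and
converging a.e.; dominated convergence on the slab (`tendsto_pairing_mollify`, stated once for
coefficients in a general Banach space so that the vector identity and the scalar entropy
inequality are the same lemma). The bridge between the iterated integrals / slice derivatives of
the definitions and slab integrals / Fréchet derivatives is `pairing_eq_setIntegral`. Everything
here is standard real analysis. [folklore]

The sibling file `ConservationLawLipschitzTest.lean` (`IsWeakSolution.lipschitz_test`, landed in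
parallel) states the weak identity with line derivatives `lineDeriv ℝ Φ p (dirT m)` on `slab m T`;
for Lipschitz `Φ` these agree a.e. with the Fréchet derivatives used here
(`DifferentiableAt.lineDeriv_eq_fderiv` and Rademacher). The present file is the form consumed by
the later layers of this proof (`ConservationLawSlabIBP`, …) and adds the entropy inequality.

## References

* C. M. Dafermos, *Hyperbolic Conservation Laws in Continuum Physics*, Springer 2000, §4.1
  (4.1.6), §4.3 (4.3.4), §5.2 (5.2.7) [Dafermos2000].
-/

noncomputable section

open MeasureTheory Set Filter Metric ContinuousLinearMap
open scoped Topology Convolution NNReal BigOperators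

namespace Literature.Analysis.PDE.ConservationLaw

variable {m n : ℕ}

/-! ## Slice derivatives of test functions as Fréchet derivatives -/

/-- The time-slice derivative of a differentiable `φ` is `Dφ(t,x)(1,0)`. [folklore] -/
theorem hasDerivAt_timeSlice {φ : ℝ × EuclideanSpace ℝ (Fin m) → ℝ} {t : ℝ}
    {x : EuclideanSpace ℝ (Fin m)} (h : DifferentiableAt ℝ φ (t, x)) :
    HasDerivAt (fun s => φ (s, x)) (fderiv ℝ φ (t, x) (1, 0)) t := by
  have h1 : HasDerivAt (fun s : ℝ => (s, x)) (1, 0) t :=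
    (hasDerivAt_id t).prodMk (hasDerivAt_const t x)
  exact h.hasFDerivAt.comp_hasDerivAt t h1

/-- `testTimeDeriv φ t x = Dφ(t,x)(1,0)` at points of differentiability. [folklore] -/
theorem testTimeDeriv_eq_fderiv {φ : ℝ × EuclideanSpace ℝ (Fin m) → ℝ} {t : ℝ}
    {x : EuclideanSpace ℝ (Fin m)} (h : DifferentiableAt ℝ φ (t, x)) :
    testTimeDeriv φ t x = fderiv ℝ φ (t, x) (1, 0) :=
  (hasDerivAt_timeSlice h).deriv

/-- The space-slice derivative of a differentiable `φ` along `e_α` is `Dφ(t,x)(0,e_α)`.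
[folklore] -/
theorem hasDerivAt_spaceSlice {φ : ℝ × EuclideanSpace ℝ (Fin m) → ℝ} {t : ℝ}
    {x : EuclideanSpace ℝ (Fin m)} (α : Fin m) (h : DifferentiableAt ℝ φ (t, x)) :
    HasDerivAt (fun s : ℝ => φ (t, x + s • EuclideanSpace.single α (1 : ℝ)))
      (fderiv ℝ φ (t, x) (0, EuclideanSpace.single α (1 : ℝ))) 0 := by
  set v : EuclideanSpace ℝ (Fin m) := EuclideanSpace.single α (1 : ℝ)
  have h1 : HasDerivAt (fun s : ℝ => (t, x + s • v)) (0, v) 0 := by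
    have h2 : HasDerivAt (fun s : ℝ => x + s • v) v 0 := by
      simpa using ((hasDerivAt_id (0 : ℝ)).smul_const v).const_add x
    exact (hasDerivAt_const (0 : ℝ) t).prodMk h2
  have hp : (t, x + (0 : ℝ) • v) = (t, x) := by simp
  have h3 : HasFDerivAt φ (fderiv ℝ φ (t, x)) (t, x + (0 : ℝ) • v) := by
    rw [hp]; exact h.hasFDerivAt
  exact h3.comp_hasDerivAt (0 : ℝ) h1

/-- `testSpaceDeriv φ α t x = Dφ(t,x)(0,e_α)` at points of differentiability. [folklore] -/
theorem testSpaceDeriv_eq_fderiv {φ : ℝ × EuclideanSpace ℝ (Fin m) → ℝ} {t : ℝ}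
    {x : EuclideanSpace ℝ (Fin m)} (α : Fin m) (h : DifferentiableAt ℝ φ (t, x)) :
    testSpaceDeriv φ α t x = fderiv ℝ φ (t, x) (0, EuclideanSpace.single α (1 : ℝ)) :=
  (hasDerivAt_spaceSlice α h).deriv

/-- The Fréchet derivative vanishes outside the topological support. [folklore] -/
theorem fderiv_eq_zero_of_notMem_tsupport {V W : Type*} [NormedAddCommGroup V] [NormedSpace ℝ V]
    [NormedAddCommGroup W] [NormedSpace ℝ W] {φ : V → W} {p : V} (hp : p ∉ tsupport φ) :
    fderiv ℝ φ p = 0 := by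
  have h0 : φ =ᶠ[𝓝 p] fun _ => 0 := notMem_tsupport_iff_eventuallyEq.mp hp
  rw [h0.fderiv_eq]
  exact fderiv_const_apply 0

/-- Norm of the time direction `(1,0)`. [folklore] -/
theorem norm_timeDir : ‖((1 : ℝ), (0 : EuclideanSpace ℝ (Fin m)))‖ = 1 := by
  simp [Prod.norm_def]

/-- Norm of the space directions `(0,e_α)`. [folklore] -/
theorem norm_spaceDir (α : Fin m) :
    ‖((0 : ℝ), EuclideanSpace.single α (1 : ℝ))‖ = 1 := by
  simp [Prod.norm_def]

/-! ## Integrability on the slab and iterated integrals -/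

/-- A continuous compactly supported scalar function times an essentially bounded function is
integrable (on any restricted measure). [folklore] -/
theorem integrable_smul_of_norm_le {V W : Type*} [MeasurableSpace V] [TopologicalSpace V]
    [OpensMeasurableSpace V] [T2Space V] [NormedAddCommGroup W] [NormedSpace ℝ W]
    {μ : Measure V} [IsFiniteMeasureOnCompacts μ]
    {c : V → ℝ} (hc : Continuous c) (hcs : HasCompactSupport c) {w : V → W}
    (hw : AEStronglyMeasurable w μ) {M : ℝ} (hb : ∀ᵐ p ∂μ, ‖w p‖ ≤ M) :
    Integrable (fun p => c p • w p) μ :=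
  Integrable.smul_of_top_left (hc.integrable_of_hasCompactSupport hcs) (memLp_top_of_bound hw M hb)

/-- An integral over the slab `(0,T) × ℝ^m` as an iterated integral. [folklore] -/
theorem setIntegral_slab_eq_iterated {W : Type*} [NormedAddCommGroup W] [NormedSpace ℝ W]
    {T : ℝ} {F : ℝ × EuclideanSpace ℝ (Fin m) → W}
    (hF : IntegrableOn F (Ioo 0 T ×ˢ univ) volume) :
    ∫ p in Ioo 0 T ×ˢ univ, F p = ∫ t in Ioo 0 T, ∫ x, F (t, x) := by
  rw [Measure.volume_eq_prod] at hF ⊢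
  rw [setIntegral_prod F hF, Measure.restrict_univ]

/-! ## Mollified Lipschitz functions are test functions -/

/-- If `Φ = 0` for `t ≥ T'` then `ρ̄ ⋆ Φ = 0` for `t ≥ T' + rOut`. [folklore] -/
theorem mollify_eq_zero_of_time_ge (ρ : ContDiffBump (0 : ℝ × EuclideanSpace ℝ (Fin m)))
    {Φ : ℝ × EuclideanSpace ℝ (Fin m) → ℝ} {T' : ℝ} (hΦT : ∀ t x, T' ≤ t → Φ (t, x) = 0)
    {t : ℝ} {x : EuclideanSpace ℝ (Fin m)} (ht : T' + ρ.rOut ≤ t) :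
    (ρ.normed volume ⋆[lsmul ℝ ℝ, volume] Φ) (t, x) = 0 := by
  haveI : (volume : Measure (ℝ × EuclideanSpace ℝ (Fin m))).IsAddHaarMeasure :=
    Measure.prod.instIsAddHaarMeasure _ _
  apply mollify_eq_zero_of_forall_ball
  rintro ⟨s, y⟩ hz
  apply hΦT
  rw [mem_ball, Prod.dist_eq] at hz
  have h1 : dist s t < ρ.rOut := lt_of_le_of_lt (le_max_left _ _) hz
  rw [Real.dist_eq, abs_lt] at h1
  linarith

/-- The mollification of a Lipschitz, compactly supported `Φ` vanishing for `t ≥ T'` by a bump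
with `rOut ≤ 1`, `T' + rOut < T`, is an admissible test function on `[0,T)`. [folklore] -/
theorem isTestFunction_mollify (ρ : ContDiffBump (0 : ℝ × EuclideanSpace ℝ (Fin m)))
    {Φ : ℝ × EuclideanSpace ℝ (Fin m) → ℝ} {K : ℝ≥0} (hΦ : LipschitzWith K Φ)
    (hΦc : HasCompactSupport Φ) {T T' : ℝ} (hΦT : ∀ t x, T' ≤ t → Φ (t, x) = 0)
    (hρ1 : ρ.rOut ≤ 1) (hρT : T' + ρ.rOut < T) :
    IsTestFunction T (ρ.normed volume ⋆[lsmul ℝ ℝ, volume] Φ) := by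
  haveI : (volume : Measure (ℝ × EuclideanSpace ℝ (Fin m))).IsAddHaarMeasure :=
    Measure.prod.instIsAddHaarMeasure _ _
  refine ⟨?_, hasCompactSupport_mollify ρ hΦc hρ1, T' + ρ.rOut, hρT, fun t x ht => ?_⟩
  · exact contDiff_mollify ρ hΦ.continuous.locallyIntegrable
  · exact mollify_eq_zero_of_time_ge ρ hΦT ht

/-! ## The pairing and its bridge to the definitions -/

/-- **Bridge.** For a `C¹` test function `ψ` with compact support and coefficients `U`, `G_α ∘ U`
essentially bounded and measurable on the slab, the iterated pairing of `IsWeakSolution` /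
`IsEntropyAdmissible` (slice derivatives) equals the slab pairing with Fréchet derivatives.
[folklore] -/
theorem pairing_eq_setIntegral {W : Type*} [NormedAddCommGroup W] [NormedSpace ℝ W]
    [CompleteSpace W] {T : ℝ}
    {u : ℝ × EuclideanSpace ℝ (Fin m) → W} {g : Fin m → ℝ × EuclideanSpace ℝ (Fin m) → W}
    (hu : AEStronglyMeasurable u (volume.restrict (Ioo 0 T ×ˢ univ)))
    (hg : ∀ α, AEStronglyMeasurable (g α) (volume.restrict (Ioo 0 T ×ˢ univ)))
    {M : ℝ} (huM : ∀ᵐ p ∂(volume.restrict (Ioo 0 T ×ˢ univ)), ‖u p‖ ≤ M)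
    (hgM : ∀ α, ∀ᵐ p ∂(volume.restrict (Ioo 0 T ×ˢ univ)), ‖g α p‖ ≤ M)
    {ψ : ℝ × EuclideanSpace ℝ (Fin m) → ℝ} (hψ : ContDiff ℝ 1 ψ) (hψc : HasCompactSupport ψ) :
    (∫ t in Ioo 0 T, ∫ x, (testTimeDeriv ψ t x • u (t, x)
        + ∑ α : Fin m, testSpaceDeriv ψ α t x • g α (t, x)))
      = ∫ p in Ioo 0 T ×ˢ univ, (fderiv ℝ ψ p (1, 0) • u p
        + ∑ α : Fin m, fderiv ℝ ψ p (0, EuclideanSpace.single α (1 : ℝ)) • g α p) := by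
  have hψd : Differentiable ℝ ψ := hψ.differentiable one_ne_zero
  have hcont : ∀ v, Continuous fun p => fderiv ℝ ψ p v := fun v =>
    (hψ.continuous_fderiv one_ne_zero).clm_apply continuous_const
  have hcs : ∀ v, HasCompactSupport fun p => fderiv ℝ ψ p v := fun v =>
    hψc.fderiv_apply (𝕜 := ℝ) v
  set F : ℝ × EuclideanSpace ℝ (Fin m) → W := fun p => fderiv ℝ ψ p (1, 0) • u p
        + ∑ α : Fin m, fderiv ℝ ψ p (0, EuclideanSpace.single α (1 : ℝ)) • g α p with hF
  have hFi : IntegrableOn F (Ioo 0 T ×ˢ univ) volume := by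
    refine Integrable.add ?_ (integrable_finsetSum _ fun α _ => ?_)
    · exact integrable_smul_of_norm_le (hcont _) (hcs _) hu huM
    · exact integrable_smul_of_norm_le (hcont _) (hcs _) (hg α) (hgM α)
  rw [setIntegral_slab_eq_iterated hFi]
  refine setIntegral_congr_fun measurableSet_Ioo fun t _ => ?_
  refine integral_congr_ae (ae_of_all _ fun x => ?_)
  simp only [hF, testTimeDeriv_eq_fderiv (hψd _), testSpaceDeriv_eq_fderiv _ (hψd _)]

/-! ## The limit of the pairings of the mollifications -/

/-- **Continuity of the pairing under mollification of a Lipschitz test function.** For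
coefficients `u`, `g_α` essentially bounded and measurable on the slab `(0,T) × ℝ^m`, `u₀`
bounded measurable, `Φ` Lipschitz with compact support and bumps `ρ_k` with `rOut → 0`,
`rOut ≤ 2 rIn`, `rOut ≤ 1`:
`Λ(ρ̄_k ⋆ Φ) → Λ(Φ)`, where
`Λ(ψ) = ∫_slab [Dψ(1,0) • u + ∑_α Dψ(0,e_α) • g_α] + ∫ ψ(0,x) • u₀(x) dx`
(for `Φ` the derivative is the a.e. Fréchet derivative). Dominated convergence, using
`ae_tendsto_fderiv_mollify` and `abs_fderiv_mollify_le`. [folklore] -/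
theorem tendsto_pairing_mollify {W : Type*} [NormedAddCommGroup W] [NormedSpace ℝ W]
    [CompleteSpace W] {T : ℝ}
    {u : ℝ × EuclideanSpace ℝ (Fin m) → W} {g : Fin m → ℝ × EuclideanSpace ℝ (Fin m) → W}
    {u₀ : EuclideanSpace ℝ (Fin m) → W}
    (hu : AEStronglyMeasurable u (volume.restrict (Ioo 0 T ×ˢ univ)))
    (hg : ∀ α, AEStronglyMeasurable (g α) (volume.restrict (Ioo 0 T ×ˢ univ)))
    (hu₀ : AEStronglyMeasurable u₀ volume)
    {M : ℝ} (huM : ∀ᵐ p ∂(volume.restrict (Ioo 0 T ×ˢ univ)), ‖u p‖ ≤ M)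
    (hgM : ∀ α, ∀ᵐ p ∂(volume.restrict (Ioo 0 T ×ˢ univ)), ‖g α p‖ ≤ M)
    (hu₀M : ∀ x, ‖u₀ x‖ ≤ M)
    {Φ : ℝ × EuclideanSpace ℝ (Fin m) → ℝ} {K : ℝ≥0} (hΦ : LipschitzWith K Φ)
    (hΦc : HasCompactSupport Φ)
    {ρs : ℕ → ContDiffBump (0 : ℝ × EuclideanSpace ℝ (Fin m))}
    (hr : Tendsto (fun k => (ρs k).rOut) atTop (𝓝 0)) (hr2 : ∀ k, (ρs k).rOut ≤ 2 * (ρs k).rIn)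
    (hr1 : ∀ k, (ρs k).rOut ≤ 1) :
    Tendsto (fun k =>
      (∫ p in Ioo 0 T ×ˢ univ,
        (fderiv ℝ ((ρs k).normed volume ⋆[lsmul ℝ ℝ, volume] Φ) p (1, 0) • u p
          + ∑ α : Fin m, fderiv ℝ ((ρs k).normed volume ⋆[lsmul ℝ ℝ, volume] Φ) p
              (0, EuclideanSpace.single α (1 : ℝ)) • g α p))
      + ∫ x, ((ρs k).normed volume ⋆[lsmul ℝ ℝ, volume] Φ) (0, x) • u₀ x) atTop
      (𝓝 ((∫ p in Ioo 0 T ×ˢ univ, (fderiv ℝ Φ p (1, 0) • u p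
          + ∑ α : Fin m, fderiv ℝ Φ p (0, EuclideanSpace.single α (1 : ℝ)) • g α p))
        + ∫ x, Φ (0, x) • u₀ x)) := by
  haveI : (volume : Measure (ℝ × EuclideanSpace ℝ (Fin m))).IsAddHaarMeasure :=
    Measure.prod.instIsAddHaarMeasure _ _
  -- notation
  set Φk : ℕ → ℝ × EuclideanSpace ℝ (Fin m) → ℝ :=
    fun k => (ρs k).normed volume ⋆[lsmul ℝ ℝ, volume] Φ with hΦk
  set e₀ : ℝ × EuclideanSpace ℝ (Fin m) := (1, 0) with he₀
  set e : Fin m → ℝ × EuclideanSpace ℝ (Fin m) :=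
    fun α => (0, EuclideanSpace.single α (1 : ℝ)) with he
  have he₀n : ‖e₀‖ = 1 := norm_timeDir
  have hen : ∀ α, ‖e α‖ = 1 := fun α => norm_spaceDir α
  -- the compact set carrying all supports
  set K₁ : Set (ℝ × EuclideanSpace ℝ (Fin m)) := cthickening 1 (tsupport Φ) with hK₁
  have hK₁c : IsCompact K₁ := hΦc.isCompact.cthickening
  have hsuppk : ∀ k, tsupport (Φk k) ⊆ K₁ := fun k =>
    (tsupport_mollify_subset (ρs k) Φ).trans (cthickening_mono (hr1 k) _)
  have hsupp : tsupport Φ ⊆ K₁ := self_subset_cthickening _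
  -- smoothness and bounds for the mollifications
  have hΦk_smooth : ∀ k, ContDiff ℝ 1 (Φk k) := fun k =>
    contDiff_mollify (ρs k) hΦ.continuous.locallyIntegrable
  have hΦk_cont : ∀ k v, Continuous fun p => fderiv ℝ (Φk k) p v := fun k v =>
    ((hΦk_smooth k).continuous_fderiv one_ne_zero).clm_apply continuous_const
  have hbd : ∀ k p v, |fderiv ℝ (Φk k) p v| ≤ K * ‖v‖ := fun k p v =>
    abs_fderiv_mollify_le (ρs k) hΦ p v
  have hbd' : ∀ p v, |fderiv ℝ Φ p v| ≤ K * ‖v‖ := fun p v =>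
    abs_fderiv_apply_le_of_lipschitz hΦ p v
  have hM : 0 ≤ M := (norm_nonneg _).trans (hu₀M 0)
  refine Tendsto.add ?_ ?_
  · -- the slab term: dominated convergence on `volume.restrict slab`
    set μS : Measure (ℝ × EuclideanSpace ℝ (Fin m)) := volume.restrict (Ioo 0 T ×ˢ univ)
      with hμS
    set B : ℝ := K * M + ∑ _α : Fin m, K * M with hB
    set bound : ℝ × EuclideanSpace ℝ (Fin m) → ℝ := K₁.indicator (fun _ => B) with hbound
    refine tendsto_integral_of_dominated_convergence bound ?_ ?_ ?_ ?_
    · intro k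
      refine AEStronglyMeasurable.add ?_ (Finset.aestronglyMeasurable_fun_sum _ fun α _ => ?_)
      · exact (hΦk_cont k e₀).aestronglyMeasurable.smul hu
      · exact (hΦk_cont k (e α)).aestronglyMeasurable.smul (hg α)
    · have : IntegrableOn bound (Ioo 0 T ×ˢ univ) volume :=
        ((integrable_indicator_iff hK₁c.measurableSet).mpr
          (integrableOn_const hK₁c.measure_lt_top.ne)).integrableOn
      exact this
    · intro k
      filter_upwards [huM, (ae_all_iff.mpr hgM : ∀ᵐ p ∂μS, ∀ α, ‖g α p‖ ≤ M)] with p hup hgp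
      by_cases hp : p ∈ K₁
      · rw [hbound, indicator_of_mem hp]
        refine (norm_add_le _ _).trans (add_le_add ?_ ((norm_sum_le _ _).trans
          (Finset.sum_le_sum fun α _ => ?_)))
        · rw [norm_smul, Real.norm_eq_abs]
          exact mul_le_mul ((hbd k p e₀).trans (by rw [he₀n, mul_one])) hup (norm_nonneg _) K.2
        · rw [norm_smul, Real.norm_eq_abs]
          exact mul_le_mul ((hbd k p (e α)).trans (by rw [hen, mul_one])) (hgp α)
            (norm_nonneg _) K.2
      · have hp' : p ∉ tsupport (Φk k) := fun h => hp (hsuppk k h)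
        rw [hbound, indicator_of_notMem hp, fderiv_eq_zero_of_notMem_tsupport hp']
        simp
    · have hae : ∀ᵐ p ∂μS, Tendsto (fun k => fderiv ℝ (Φk k) p e₀) atTop
          (𝓝 (fderiv ℝ Φ p e₀)) ∧ ∀ α, Tendsto (fun k => fderiv ℝ (Φk k) p (e α)) atTop
          (𝓝 (fderiv ℝ Φ p (e α))) := by
        apply ae_restrict_of_ae
        have h1 := ae_tendsto_fderiv_mollify (μ := volume) hr hr2 hΦ e₀
        have h2 : ∀ᵐ p ∂(volume : Measure (ℝ × EuclideanSpace ℝ (Fin m))), ∀ α,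
            Tendsto (fun k => fderiv ℝ (Φk k) p (e α)) atTop (𝓝 (fderiv ℝ Φ p (e α))) :=
          ae_all_iff.mpr fun α => ae_tendsto_fderiv_mollify (μ := volume) hr hr2 hΦ (e α)
        filter_upwards [h1, h2] with p hp1 hp2
        exact ⟨hp1, hp2⟩
      filter_upwards [hae] with p hp
      exact (hp.1.smul_const (u p)).add (tendsto_finsetSum _ fun α _ =>
        (hp.2 α).smul_const (g α p))
  · -- the initial term: dominated convergence on `ℝ^m`
    obtain ⟨MΦ, hMΦ⟩ := hΦ.continuous.bounded_above_of_compact_support hΦc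
    have hMΦ' : ∀ z, |Φ z| ≤ MΦ := fun z => by simpa [Real.norm_eq_abs] using hMΦ z
    set K₀ : Set (EuclideanSpace ℝ (Fin m)) := Prod.snd '' K₁ with hK₀
    have hK₀c : IsCompact K₀ := hK₁c.image continuous_snd
    set bound₀ : EuclideanSpace ℝ (Fin m) → ℝ := K₀.indicator (fun _ => MΦ * M) with hbound₀
    have hzero : ∀ (ψ : ℝ × EuclideanSpace ℝ (Fin m) → ℝ) (x : EuclideanSpace ℝ (Fin m)),
        tsupport ψ ⊆ K₁ → x ∉ K₀ → ψ (0, x) = 0 := by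
      intro ψ x hψ hx
      apply image_eq_zero_of_notMem_tsupport
      intro h
      exact hx ⟨(0, x), hψ h, rfl⟩
    refine tendsto_integral_of_dominated_convergence bound₀ ?_ ?_ ?_ ?_
    · intro k
      have hc : Continuous fun x : EuclideanSpace ℝ (Fin m) => Φk k (0, x) :=
        (hΦk_smooth k).continuous.comp (by fun_prop)
      exact hc.aestronglyMeasurable.smul hu₀
    · exact (integrable_indicator_iff hK₀c.measurableSet).mpr
        (integrableOn_const hK₀c.measure_lt_top.ne)
    · intro k
      refine ae_of_all _ fun x => ?_
      by_cases hx : x ∈ K₀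
      · rw [hbound₀, indicator_of_mem hx, norm_smul, Real.norm_eq_abs]
        exact mul_le_mul (abs_mollify_le (ρs k) hMΦ' _) (hu₀M x) (norm_nonneg _)
          ((abs_nonneg _).trans (hMΦ' 0))
      · have h0 : ((ρs k).normed volume ⋆[lsmul ℝ ℝ, volume] Φ) (0, x) = 0 :=
          hzero (Φk k) x (hsuppk k) hx
        rw [hbound₀, indicator_of_notMem hx, h0]
        simp
    · refine ae_of_all _ fun x => ?_
      exact (tendsto_mollify_of_lipschitz (μ := volume) hr hΦ (0, x)).smul_const (u₀ x)

/-! ## Weak solutions and admissibility against Lipschitz test functions -/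

/-- **Weak solutions tested against Lipschitz functions (Dafermos (4.1.6)).** If `U` is a weak
solution on `[0,T)` with data `U₀` (tree definition, `C¹` test functions) and `G_α(U)` is
essentially bounded on the slab, then for every Lipschitz `Φ` with compact support and `Φ = 0`
for `t ≥ T'`, `T' < T`,
`∫_{(0,T)×ℝ^m} [DΦ(1,0) • U + ∑_α DΦ(0,e_α) • G_α(U)] + ∫ Φ(0,x) • U₀(x) dx = 0`.
[cite: Dafermos2000, §4.1 (4.1.6)] -/
theorem IsWeakSolution.lipschitzTest {O : Set (EuclideanSpace ℝ (Fin n))}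
    {G : Fin m → EuclideanSpace ℝ (Fin n) → EuclideanSpace ℝ (Fin n)} {T : ℝ}
    {U : ℝ → EuclideanSpace ℝ (Fin m) → EuclideanSpace ℝ (Fin n)}
    {U₀ : EuclideanSpace ℝ (Fin m) → EuclideanSpace ℝ (Fin n)}
    (hU : IsWeakSolution O G T U U₀)
    {MG : ℝ} (hGM : ∀ α, ∀ t ∈ Ioo 0 T, ∀ x, ‖G α (U t x)‖ ≤ MG)
    {Φ : ℝ × EuclideanSpace ℝ (Fin m) → ℝ} {K : ℝ≥0} (hΦ : LipschitzWith K Φ)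
    (hΦc : HasCompactSupport Φ) {T' : ℝ} (hT' : T' < T) (hΦT : ∀ t x, T' ≤ t → Φ (t, x) = 0) :
    (∫ p in Ioo 0 T ×ˢ univ, (fderiv ℝ Φ p (1, 0) • U p.1 p.2
        + ∑ α : Fin m, fderiv ℝ Φ p (0, EuclideanSpace.single α (1 : ℝ)) • G α (U p.1 p.2)))
      + ∫ x, Φ (0, x) • U₀ x = 0 := by
  haveI : (volume : Measure (ℝ × EuclideanSpace ℝ (Fin m))).IsAddHaarMeasure :=
    Measure.prod.instIsAddHaarMeasure _ _
  obtain ⟨hUm, hU₀m, -, -, ⟨C, hUC, hU₀C⟩, hGli, hweak⟩ := hU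
  obtain ⟨ρs, hr, hr2, hr1, -⟩ := exists_bumpSeq (V := ℝ × EuclideanSpace ℝ (Fin m))
  -- data for the pairing lemma
  set M : ℝ := max C MG with hMdef
  have hu : AEStronglyMeasurable (fun p : ℝ × EuclideanSpace ℝ (Fin m) => U p.1 p.2)
      (volume.restrict (Ioo 0 T ×ˢ univ)) := hUm.aestronglyMeasurable
  have hg : ∀ α, AEStronglyMeasurable (fun p : ℝ × EuclideanSpace ℝ (Fin m) => G α (U p.1 p.2))
      (volume.restrict (Ioo 0 T ×ˢ univ)) := fun α =>
    (hGli α).aestronglyMeasurable.mono_measure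
      (Measure.restrict_mono (Set.prod_mono Ioo_subset_Ico_self le_rfl) le_rfl)
  have hslab : ∀ᵐ p ∂(volume.restrict (Ioo (0 : ℝ) T ×ˢ (univ : Set (EuclideanSpace ℝ (Fin m))))),
      p ∈ Ioo (0 : ℝ) T ×ˢ (univ : Set (EuclideanSpace ℝ (Fin m))) :=
    ae_restrict_mem (measurableSet_Ioo.prod MeasurableSet.univ)
  have huM : ∀ᵐ p ∂(volume.restrict (Ioo 0 T ×ˢ univ)),
      ‖(fun p : ℝ × EuclideanSpace ℝ (Fin m) => U p.1 p.2) p‖ ≤ M := by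
    filter_upwards [hslab] with p hp
    exact (hUC p.1 (Ioo_subset_Ico_self hp.1) p.2).trans (le_max_left _ _)
  have hgM : ∀ α, ∀ᵐ p ∂(volume.restrict (Ioo 0 T ×ˢ univ)),
      ‖(fun p : ℝ × EuclideanSpace ℝ (Fin m) => G α (U p.1 p.2)) p‖ ≤ M := by
    intro α
    filter_upwards [hslab] with p hp
    exact (hGM α p.1 hp.1 p.2).trans (le_max_right _ _)
  have hu₀M : ∀ x, ‖U₀ x‖ ≤ M := fun x => (hU₀C x).trans (le_max_left _ _)
  have hlim := tendsto_pairing_mollify hu hg hU₀m.aestronglyMeasurable huM hgM hu₀M hΦ hΦc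
    hr hr2 hr1
  -- for `k` large the mollification is a test function, and the pairing vanishes
  have hev : ∀ᶠ k in atTop, T' + (ρs k).rOut < T := by
    have : Tendsto (fun k => T' + (ρs k).rOut) atTop (𝓝 (T' + 0)) := hr.const_add T'
    rw [add_zero] at this
    exact this.eventually (gt_mem_nhds hT')
  have hzero : ∀ᶠ k in atTop,
      (∫ p in Ioo 0 T ×ˢ univ,
        (fderiv ℝ ((ρs k).normed volume ⋆[lsmul ℝ ℝ, volume] Φ) p (1, 0) • U p.1 p.2
          + ∑ α : Fin m, fderiv ℝ ((ρs k).normed volume ⋆[lsmul ℝ ℝ, volume] Φ) p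
              (0, EuclideanSpace.single α (1 : ℝ)) • G α (U p.1 p.2)))
      + ∫ x, ((ρs k).normed volume ⋆[lsmul ℝ ℝ, volume] Φ) (0, x) • U₀ x = 0 := by
    filter_upwards [hev] with k hk
    have htest := isTestFunction_mollify (ρs k) hΦ hΦc hΦT (hr1 k) hk
    have hid := hweak _ htest
    have key := pairing_eq_setIntegral hu hg huM hgM htest.1 htest.2.1
    simp only at key
    rw [key] at hid
    exact hid
  exact tendsto_nhds_unique hlim (tendsto_const_nhds.congr' (hzero.mono fun k hk => hk.symm))

/-- **Admissibility tested against Lipschitz functions (Dafermos (4.3.4)).** If `U` (data `U₀`)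
satisfies the entropy inequality of `IsEntropyAdmissible` for `(η, q)` (tree definition, `C¹`
test functions), `U` is jointly measurable, `η(U)`, `q_α(U)` are essentially bounded on the slab
and `η(U₀)` is bounded measurable, then for every NONNEGATIVE Lipschitz `Φ` with compact support
and `Φ = 0` for `t ≥ T'`, `T' < T`,
`0 ≤ ∫_{(0,T)×ℝ^m} [DΦ(1,0) η(U) + ∑_α DΦ(0,e_α) q_α(U)] + ∫ Φ(0,x) η(U₀(x)) dx`.
[cite: Dafermos2000, §4.3 (4.3.4)] -/
theorem IsEntropyAdmissible.lipschitzTest {η : EuclideanSpace ℝ (Fin n) → ℝ}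
    {q : Fin m → EuclideanSpace ℝ (Fin n) → ℝ} {T : ℝ}
    {U : ℝ → EuclideanSpace ℝ (Fin m) → EuclideanSpace ℝ (Fin n)}
    {U₀ : EuclideanSpace ℝ (Fin m) → EuclideanSpace ℝ (Fin n)}
    (hU : IsEntropyAdmissible η q T U U₀)
    (hη₀m : AEStronglyMeasurable (fun x => η (U₀ x)) volume)
    {M : ℝ} (hηM : ∀ t ∈ Ioo 0 T, ∀ x, ‖η (U t x)‖ ≤ M)
    (hqM : ∀ α, ∀ t ∈ Ioo 0 T, ∀ x, ‖q α (U t x)‖ ≤ M) (hη₀M : ∀ x, ‖η (U₀ x)‖ ≤ M)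
    {Φ : ℝ × EuclideanSpace ℝ (Fin m) → ℝ} {K : ℝ≥0} (hΦ : LipschitzWith K Φ)
    (hΦc : HasCompactSupport Φ) (hΦnn : ∀ p, 0 ≤ Φ p) {T' : ℝ} (hT' : T' < T)
    (hΦT : ∀ t x, T' ≤ t → Φ (t, x) = 0) :
    0 ≤ (∫ p in Ioo 0 T ×ˢ univ, (fderiv ℝ Φ p (1, 0) * η (U p.1 p.2)
        + ∑ α : Fin m, fderiv ℝ Φ p (0, EuclideanSpace.single α (1 : ℝ)) * q α (U p.1 p.2)))
      + ∫ x, Φ (0, x) * η (U₀ x) := by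
  haveI : (volume : Measure (ℝ × EuclideanSpace ℝ (Fin m))).IsAddHaarMeasure :=
    Measure.prod.instIsAddHaarMeasure _ _
  obtain ⟨hηli, hqli, hadm⟩ := hU
  obtain ⟨ρs, hr, hr2, hr1, -⟩ := exists_bumpSeq (V := ℝ × EuclideanSpace ℝ (Fin m))
  have hmono : volume.restrict (Ioo (0 : ℝ) T ×ˢ (univ : Set (EuclideanSpace ℝ (Fin m))))
      ≤ volume.restrict (Ico (0 : ℝ) T ×ˢ (univ : Set (EuclideanSpace ℝ (Fin m)))) :=
    Measure.restrict_mono (Set.prod_mono Ioo_subset_Ico_self le_rfl) le_rfl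
  have hu : AEStronglyMeasurable (fun p : ℝ × EuclideanSpace ℝ (Fin m) => η (U p.1 p.2))
      (volume.restrict (Ioo 0 T ×ˢ univ)) := hηli.aestronglyMeasurable.mono_measure hmono
  have hg : ∀ α, AEStronglyMeasurable (fun p : ℝ × EuclideanSpace ℝ (Fin m) => q α (U p.1 p.2))
      (volume.restrict (Ioo 0 T ×ˢ univ)) := fun α =>
    (hqli α).aestronglyMeasurable.mono_measure hmono
  have hslab : ∀ᵐ p ∂(volume.restrict (Ioo (0 : ℝ) T ×ˢ (univ : Set (EuclideanSpace ℝ (Fin m))))),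
      p ∈ Ioo (0 : ℝ) T ×ˢ (univ : Set (EuclideanSpace ℝ (Fin m))) :=
    ae_restrict_mem (measurableSet_Ioo.prod MeasurableSet.univ)
  have huM : ∀ᵐ p ∂(volume.restrict (Ioo 0 T ×ˢ univ)),
      ‖(fun p : ℝ × EuclideanSpace ℝ (Fin m) => η (U p.1 p.2)) p‖ ≤ M := by
    filter_upwards [hslab] with p hp
    exact hηM p.1 hp.1 p.2
  have hgM : ∀ α, ∀ᵐ p ∂(volume.restrict (Ioo 0 T ×ˢ univ)),
      ‖(fun p : ℝ × EuclideanSpace ℝ (Fin m) => q α (U p.1 p.2)) p‖ ≤ M := by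
    intro α
    filter_upwards [hslab] with p hp
    exact hqM α p.1 hp.1 p.2
  have hlim := tendsto_pairing_mollify (W := ℝ) hu hg hη₀m huM hgM hη₀M hΦ hΦc hr hr2 hr1
  have hev : ∀ᶠ k in atTop, T' + (ρs k).rOut < T := by
    have : Tendsto (fun k => T' + (ρs k).rOut) atTop (𝓝 (T' + 0)) := hr.const_add T'
    rw [add_zero] at this
    exact this.eventually (gt_mem_nhds hT')
  have hnn : ∀ᶠ k in atTop,
      0 ≤ (∫ p in Ioo 0 T ×ˢ univ,
        (fderiv ℝ ((ρs k).normed volume ⋆[lsmul ℝ ℝ, volume] Φ) p (1, 0) • η (U p.1 p.2)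
          + ∑ α : Fin m, fderiv ℝ ((ρs k).normed volume ⋆[lsmul ℝ ℝ, volume] Φ) p
              (0, EuclideanSpace.single α (1 : ℝ)) • q α (U p.1 p.2)))
      + ∫ x, ((ρs k).normed volume ⋆[lsmul ℝ ℝ, volume] Φ) (0, x) • η (U₀ x) := by
    filter_upwards [hev] with k hk
    have htest := isTestFunction_mollify (ρs k) hΦ hΦc hΦT (hr1 k) hk
    have hid := hadm _ htest (fun p => mollify_nonneg (ρs k) hΦnn p)
    have key := pairing_eq_setIntegral (W := ℝ) hu hg huM hgM htest.1 htest.2.1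
    simp only [smul_eq_mul] at key
    rw [key] at hid
    simpa only [smul_eq_mul] using hid
  have := ge_of_tendsto hlim hnn
  simpa only [smul_eq_mul] using this

end Literature.Analysis.PDE.ConservationLaw
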